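import Literature.NumberTheory.EllipticCurves.CasselsTateGeneralCaseKernel
import Literature.NumberTheory.GaloisRepresentations.GaloisCohomologyMuTwoFiniteSupport
import HarnessLib

/-!
# Admissible choices for the Poitou–Tate cochain pairing of an ARBITRARY `μₙ`-valued pairing `X × Y → μₙ`:
# independence of the choice, and — for THE canonical invariant maps — a PRODUCED finite support (step S1' of SHA2-BRIDGE-w3g7)

Route `SemiOrdinaryEisensteinDescent` (BSD, rung W-ALL row 2·3@3), Kolyvagin column, Cassels–Tate lane: print item
`CasselsTateLevelInputsFact` (stmt-BirchSwinnertonDyer-20191), last input `hPTc` (Milne I Thm. 4.10 (a) for `Ш²(K, E[q])` in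
`PTChoice` cochain form, p628097).  Sequel of `…ShaTwoCochainChoiceIndependence` (S1, p633268: the same for the tree's
`PTChoice`, i.e. for `X = Y = E[m]` and the descended Weil pairing).  The Ш²-cochain bridge
(`Cruxes/WildKolyvaginUpperAtThree/SHA2-BRIDGE-w3g7.md`) compares TWO admissible choices for the SAME pair `(F, g)` of cocycles of
`A^D = Hom(A, μₙ)` and `A` under the EVALUATION pairing — the push-forward of the `hPTc` hypothesis' `PTChoice` along
`θ : A ≅ A^D`, and the explicit choice built from cell bsd-schneider's `Ψ` (S2a/S2b) — so the independence statement is needed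
for a general pairing; this file proves it for ANY continuous equivariant pairing `P : X × Y → μₙ` of discrete `Γ_K`-modules,
with the admissible choices given by their raw components (no structure, no definition): a global `2`-cochain `h` of `μₙ`
with `dh = f ∪_P g` and local `1`-cochains `φ_v` of `X|_{Γ_v}` with `dφ_v = f_v`; local `2`-cocycle `φ_v ∪_P g_v − h_v`
(`ContPairing.cupSubCocycle`), local term `inv_v [φ_v ∪_P g_v − h_v]`.  Width seat `bsd-wall-soed-p2-w3` g7;
`--supports stmt-BirchSwinnertonDyer-20480`, helper.  Route-free.

* `dTwo_resCochain₂_of_cupCocycle₂₁` — the restricted boundary condition `d(h|_v) = f_v ∪ g_v` (as `PTChoice.dTwo_res`);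
* `pair_localCocycle_eq` — ON THE NOSE `φ'_v ∪ g_v − h'_v = (φ_v ∪ g_v − h_v) + ζ_v ∪ g_v − z_v`, `ζ_v = φ'_v − φ_v` a `1`-cocycle,
  `z = h' − h` a global `2`-cocycle; `pair_locClass₂_eq` — on classes; `pair_localTerm_eq_sub` — for `[g_v] = 0` the local terms
  differ by `−inv_v (loc_v [z])`;
* `pair_sum_localTerm_eq` — equal sums over a common support, for a family `inv` with `SumInvLocalizationEqZero`;
* **`pair_support_and_sum_eq_zero_canonical`** — for THE maps `LocalInvariants.canonical K n`: if ONE admissible choice has local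
  terms vanishing off a finite `S` and summing to `0`, then ANY other admissible choice has local terms vanishing off the finite set
  `S ∪ S_z` PRODUCED by `exists_finset_place_forall_localization_mu_two_eq_zero` (tp2-p3 g6) and summing to `0` there — no
  finite-support hypothesis on the second choice (the bridge's choice has no a-priori support).

THEOREMS ONLY; no case of BSD, Poitou–Tate or Cassels–Tate is proved here.

## References
* [MilneADT2006] J. S. Milne, *Arithmetic Duality Theorems*, 2nd ed. (2006), I §4 Thm. 4.10 (a), Lemma 4.8; §6 proof of Prop. 6.9.
* [CasselsFrohlichANT1967] J. W. S. Cassels, A. Fröhlich (eds.), *Algebraic Number Theory* (1967), Ch. VII §7.3 Prop. 7.3, §11.2.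
-/

noncomputable section

open scoped Classical

-- `Summit.<P>.<Sub>` repeats `BirchSwinnertonDyer` by the tree's layout convention (D-0017)
set_option linter.dupNamespace false
set_option autoImplicit false

namespace Summit.BirchSwinnertonDyer.BirchSwinnertonDyer.Theorems.ShaTwoCochain

open CategoryTheory Field Function NumberField
open Literature.NumberTheory.EllipticCurves
open Literature.NumberTheory.GaloisRepresentations Literature.NumberTheory.GaloisCohomology
open Literature.NumberTheory.GaloisRepresentations.DiscreteGaloisModule (mu MuCarrier)
open scoped ContRepresentation

variable {K : Type} [Field K] [NumberField K] {n : ℕ}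
variable {MX MY : Type} [AddCommGroup MX] [TopologicalSpace MX] [DiscreteTopology MX]
  [AddCommGroup MY] [TopologicalSpace MY] [DiscreteTopology MY]
variable {ρX : DiscreteGaloisModule K MX} {ρY : DiscreteGaloisModule K MY}
variable (P : ContPairing ρX.toTopRep ρY.toTopRep (mu K n).toTopRep)
-- the local pairings: the SAME bilinear map on the restricted modules (for a pairing built with `DiscreteGaloisModule.pairing`
-- from a biadditive `B`, take `Pv v := pairing (ρX.toLocal v) (ρY.toLocal v) ((mu K n).toLocal v) B _` and `hPv := rfl`)
variable (Pv : (v : Place K) →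
    ContPairing (DiscreteGaloisModule.toTopRep (GaloisRep.restrictField (Place.Completion v) ρX))
      (DiscreteGaloisModule.toTopRep (GaloisRep.restrictField (Place.Completion v) ρY))
      (DiscreteGaloisModule.toTopRep (GaloisRep.restrictField (Place.Completion v) (mu K n))))
  (hPv : ∀ (v : Place K) (x : MX) (y : MY), (Pv v).toLin x y = P.toLin x y)
variable {f : contTwoCocycles ρX.toTopRep} {g : contOneCocycles ρY.toTopRep}

/-! ## The restricted boundary condition -/

include hPv in
/-- `d(h|_v) = f_v ∪_P g_v` at a place `v` from the global `dh = f ∪_P g` (as `PTChoice.dTwo_res`). [folklore] -/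
theorem dTwo_resCochain₂_of_cupCocycle₂₁ (h : C(absoluteGaloisGroup K × absoluteGaloisGroup K, MuCarrier K n))
    (hh : ∀ σ τ υ : absoluteGaloisGroup K, (P.cupCocycle₂₁ f g).1 (σ, τ, υ) = dTwo (mu K n).toTopRep h σ τ υ)
    (v : Place K) (σ τ υ : absoluteGaloisGroup (Place.Completion v)) :
    ((Pv v).cupCocycle₂₁ (resTwo ρX (Place.Completion v) f) (resOne ρY (Place.Completion v) g)).1 (σ, τ, υ) =
      dTwo (DiscreteGaloisModule.toTopRep (GaloisRep.restrictField (Place.Completion v) (mu K n)))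
        (resCochain₂ (Place.Completion v) h) σ τ υ := by
  have h0 := hh (absGaloisRestrict K (Place.Completion v) σ) (absGaloisRestrict K (Place.Completion v) τ)
    (absGaloisRestrict K (Place.Completion v) υ)
  rw [ContPairing.cupCocycle₂₁_apply, dTwo_apply] at h0
  rw [ContPairing.cupCocycle₂₁_apply, dTwo_apply, hPv, resTwo_apply, resOne_apply,
    resOne_apply, resCochain₂_apply, resCochain₂_apply, resCochain₂_apply, resCochain₂_apply]
  simp only [map_mul (absGaloisRestrict K (Place.Completion v))]
  exact h0

/-! ## Two admissible choices for the same `(f, g)` -/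

section Two

variable (h₁ h₂ : C(absoluteGaloisGroup K × absoluteGaloisGroup K, MuCarrier K n))
  (hh₁ : ∀ σ τ υ : absoluteGaloisGroup K, (P.cupCocycle₂₁ f g).1 (σ, τ, υ) = dTwo (mu K n).toTopRep h₁ σ τ υ)
  (hh₂ : ∀ σ τ υ : absoluteGaloisGroup K, (P.cupCocycle₂₁ f g).1 (σ, τ, υ) = dTwo (mu K n).toTopRep h₂ σ τ υ)
  (φ₁ φ₂ : (v : Place K) → C(absoluteGaloisGroup (Place.Completion v), MX))
  (hφ₁ : ∀ (v : Place K) (σ τ : absoluteGaloisGroup (Place.Completion v)),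
    (resTwo ρX (Place.Completion v) f).1 (σ, τ) =
      (DiscreteGaloisModule.toTopRep (GaloisRep.restrictField (Place.Completion v) ρX)).ρ σ (φ₁ v τ) -
        φ₁ v (σ * τ) + φ₁ v σ)
  (hφ₂ : ∀ (v : Place K) (σ τ : absoluteGaloisGroup (Place.Completion v)),
    (resTwo ρX (Place.Completion v) f).1 (σ, τ) =
      (DiscreteGaloisModule.toTopRep (GaloisRep.restrictField (Place.Completion v) ρX)).ρ σ (φ₂ v τ) -
        φ₂ v (σ * τ) + φ₂ v σ)

include hφ₁ hφ₂ in
/-- Two local primitives of `f_v` differ by a `1`-cocycle `ζ_v = φ'_v − φ_v`. [folklore] -/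
theorem pair_phi_sub_mem (v : Place K) :
    φ₂ v - φ₁ v ∈ contOneCocycles (DiscreteGaloisModule.toTopRep (GaloisRep.restrictField (Place.Completion v) ρX)) :=
  fun σ τ => by
  have e1 := hφ₁ v σ τ
  have e2 := hφ₂ v σ τ
  rw [e1] at e2
  simp only [ContinuousMap.sub_apply, map_sub]
  rw [← sub_eq_zero]
  have e3 : φ₂ v (σ * τ) - φ₁ v (σ * τ) -
      (φ₂ v σ - φ₁ v σ +
        ((DiscreteGaloisModule.toTopRep (GaloisRep.restrictField (Place.Completion v) ρX)).ρ σ (φ₂ v τ) -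
          (DiscreteGaloisModule.toTopRep (GaloisRep.restrictField (Place.Completion v) ρX)).ρ σ (φ₁ v τ))) =
      ((DiscreteGaloisModule.toTopRep (GaloisRep.restrictField (Place.Completion v) ρX)).ρ σ (φ₁ v τ) - φ₁ v (σ * τ) +
          φ₁ v σ) -
        ((DiscreteGaloisModule.toTopRep (GaloisRep.restrictField (Place.Completion v) ρX)).ρ σ (φ₂ v τ) - φ₂ v (σ * τ) +
          φ₂ v σ) := by
    abel
  rw [e3, e2, sub_self]

omit [NumberField K] in
include hh₁ hh₂ in
/-- Two global `2`-cochains with `dh = dh' = f ∪_P g` differ by a `2`-cocycle `z = h' − h`. [folklore] -/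
theorem pair_h_sub_mem : h₂ - h₁ ∈ contTwoCocycles (mu K n).toTopRep :=
  (mem_contTwoCocycles_iff_dTwo _ _).2 fun σ τ υ => by
    rw [dTwo_sub, ← hh₁, ← hh₂, sub_self]

/-- **ON THE NOSE**: `φ'_v ∪_P g_v − h'_v = (φ_v ∪_P g_v − h_v) + ζ_v ∪_P g_v − z_v`. [cite: MilneADT2006, Ch. I §6, proof of Prop. 6.9] -/
theorem pair_localCocycle_eq (v : Place K) :
    ((Pv v).cupSubCocycle (φ₂ v) (resOne ρY (Place.Completion v) g)
        (resTwo ρX (Place.Completion v) f) (hφ₂ v) (resCochain₂ (Place.Completion v) h₂)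
        (dTwo_resCochain₂_of_cupCocycle₂₁ P Pv hPv h₂ hh₂ v) :
        contTwoCocycles (DiscreteGaloisModule.toTopRep (GaloisRep.restrictField (Place.Completion v) (mu K n)))) =
      ((Pv v).cupSubCocycle (φ₁ v) (resOne ρY (Place.Completion v) g)
          (resTwo ρX (Place.Completion v) f) (hφ₁ v) (resCochain₂ (Place.Completion v) h₁)
          (dTwo_resCochain₂_of_cupCocycle₂₁ P Pv hPv h₁ hh₁ v) :
          contTwoCocycles (DiscreteGaloisModule.toTopRep (GaloisRep.restrictField (Place.Completion v) (mu K n)))) +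
        ((Pv v).cupCocycle
          (⟨φ₂ v - φ₁ v, pair_phi_sub_mem φ₁ φ₂ hφ₁ hφ₂ v⟩ :
            contOneCocycles (DiscreteGaloisModule.toTopRep (GaloisRep.restrictField (Place.Completion v) ρX)))
          (resOne ρY (Place.Completion v) g) :
          contTwoCocycles (DiscreteGaloisModule.toTopRep (GaloisRep.restrictField (Place.Completion v) (mu K n)))) -
        resTwo (mu K n) (Place.Completion v) ⟨h₂ - h₁, pair_h_sub_mem P h₁ h₂ hh₁ hh₂⟩ := by
  apply Subtype.ext
  ext p
  obtain ⟨σ, τ⟩ := p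
  simp only [Submodule.coe_add, Submodule.coe_sub, ContinuousMap.add_apply, ContinuousMap.sub_apply]
  rw [ContPairing.cupSubCocycle_apply, ContPairing.cupSubCocycle_apply, ContPairing.cupCocycle_apply_eq_smul,
    resTwo_apply, resCochain₂_apply, resCochain₂_apply]
  simp only [ContinuousMap.sub_apply, map_sub, LinearMap.sub_apply]
  abel

/-- **On classes**: `[φ'_v ∪ g_v − h'_v] = [φ_v ∪ g_v − h_v] + [ζ_v] ∪_P [g_v] − loc_v [z]`. [cite: MilneADT2006, Ch. I §6, proof of Prop. 6.9] -/
theorem pair_locClass₂_eq (v : Place K) :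
    locClass₂ (mu K n) (Place.Completion v)
        ((Pv v).cupSubCocycle (φ₂ v) (resOne ρY (Place.Completion v) g)
          (resTwo ρX (Place.Completion v) f) (hφ₂ v) (resCochain₂ (Place.Completion v) h₂)
          (dTwo_resCochain₂_of_cupCocycle₂₁ P Pv hPv h₂ hh₂ v)) =
      locClass₂ (mu K n) (Place.Completion v)
          ((Pv v).cupSubCocycle (φ₁ v) (resOne ρY (Place.Completion v) g)
            (resTwo ρX (Place.Completion v) f) (hφ₁ v) (resCochain₂ (Place.Completion v) h₁)
            (dTwo_resCochain₂_of_cupCocycle₂₁ P Pv hPv h₁ hh₁ v)) +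
          locClass₂ (mu K n) (Place.Completion v)
            ((Pv v).cupCocycle
              (⟨φ₂ v - φ₁ v, pair_phi_sub_mem φ₁ φ₂ hφ₁ hφ₂ v⟩ :
                contOneCocycles (DiscreteGaloisModule.toTopRep (GaloisRep.restrictField (Place.Completion v) ρX)))
              (resOne ρY (Place.Completion v) g)) -
        galoisCohomology.res (mu K n) (Place.Completion v) 2
          (twoCocycleClass _ ⟨h₂ - h₁, pair_h_sub_mem P h₁ h₂ hh₁ hh₂⟩) := by
  rw [pair_localCocycle_eq P Pv hPv h₁ h₂ hh₁ hh₂ φ₁ φ₂ hφ₁ hφ₂ v, locClass₂_sub, locClass₂_add, locClass₂_resTwo]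

variable (inv : LocalInvariants K n)

/-- **For `g` locally trivial at `v` the local terms differ by `−inv_v (loc_v [z])`.** [cite: MilneADT2006, Ch. I §4 Thm. 4.10 (a)] -/
theorem pair_localTerm_eq_sub (v : Place K)
    (hg : locClass ρY (Place.Completion v) (resOne ρY (Place.Completion v) g) = 0) :
    inv v (locClass₂ (mu K n) (Place.Completion v)
        ((Pv v).cupSubCocycle (φ₂ v) (resOne ρY (Place.Completion v) g)
          (resTwo ρX (Place.Completion v) f) (hφ₂ v) (resCochain₂ (Place.Completion v) h₂)
          (dTwo_resCochain₂_of_cupCocycle₂₁ P Pv hPv h₂ hh₂ v))) =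
      inv v (locClass₂ (mu K n) (Place.Completion v)
          ((Pv v).cupSubCocycle (φ₁ v) (resOne ρY (Place.Completion v) g)
            (resTwo ρX (Place.Completion v) f) (hφ₁ v) (resCochain₂ (Place.Completion v) h₁)
            (dTwo_resCochain₂_of_cupCocycle₂₁ P Pv hPv h₁ hh₁ v))) -
        inv v (galoisCohomology.localization (mu K n) v 2 (twoCocycleClass _ ⟨h₂ - h₁, pair_h_sub_mem P h₁ h₂ hh₁ hh₂⟩)) := by
  have hlr : inv v (galoisCohomology.res (mu K n) (Place.Completion v) 2
      (twoCocycleClass _ ⟨h₂ - h₁, pair_h_sub_mem P h₁ h₂ hh₁ hh₂⟩)) =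
      inv v (galoisCohomology.localization (mu K n) v 2 (twoCocycleClass _ ⟨h₂ - h₁, pair_h_sub_mem P h₁ h₂ hh₁ hh₂⟩)) := rfl
  haveI := absoluteGaloisGroup_compactSpace (Place.Completion v)
  have hcup : locClass₂ (mu K n) (Place.Completion v)
      ((Pv v).cupCocycle
        (⟨φ₂ v - φ₁ v, pair_phi_sub_mem φ₁ φ₂ hφ₁ hφ₂ v⟩ :
          contOneCocycles (DiscreteGaloisModule.toTopRep (GaloisRep.restrictField (Place.Completion v) ρX)))
        (resOne ρY (Place.Completion v) g)) = 0 := by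
    rw [locClass₂_eq, ← ContPairing.cupProduct_oneCocycleClass_eq_twoCocycleClass, ← locClass_eq ρY, hg]
    exact map_zero _
  rw [← hlr, pair_locClass₂_eq P Pv hPv h₁ h₂ hh₁ hh₂ φ₁ φ₂ hφ₁ hφ₂ v, hcup, add_zero]
  exact map_sub (inv v) _ _

/-- **Independence of the admissible choice over a common support**, for a family `inv` with the reciprocity law on
`H²(K, μₙ)`. [cite: MilneADT2006, Ch. I §4 Thm. 4.10 (a); §6 proof of Prop. 6.9] -/
theorem pair_sum_localTerm_eq (hPT' : inv.SumInvLocalizationEqZero)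
    (hg : ∀ v : Place K, locClass ρY (Place.Completion v) (resOne ρY (Place.Completion v) g) = 0)
    {S : Finset (Place K)}
    (hS₁ : ∀ v ∉ S, inv v (locClass₂ (mu K n) (Place.Completion v)
        ((Pv v).cupSubCocycle (φ₁ v) (resOne ρY (Place.Completion v) g)
          (resTwo ρX (Place.Completion v) f) (hφ₁ v) (resCochain₂ (Place.Completion v) h₁)
          (dTwo_resCochain₂_of_cupCocycle₂₁ P Pv hPv h₁ hh₁ v))) = 0)
    (hS₂ : ∀ v ∉ S, inv v (locClass₂ (mu K n) (Place.Completion v)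
        ((Pv v).cupSubCocycle (φ₂ v) (resOne ρY (Place.Completion v) g)
          (resTwo ρX (Place.Completion v) f) (hφ₂ v) (resCochain₂ (Place.Completion v) h₂)
          (dTwo_resCochain₂_of_cupCocycle₂₁ P Pv hPv h₂ hh₂ v))) = 0) :
    ∑ v ∈ S, inv v (locClass₂ (mu K n) (Place.Completion v)
        ((Pv v).cupSubCocycle (φ₂ v) (resOne ρY (Place.Completion v) g)
          (resTwo ρX (Place.Completion v) f) (hφ₂ v) (resCochain₂ (Place.Completion v) h₂)
          (dTwo_resCochain₂_of_cupCocycle₂₁ P Pv hPv h₂ hh₂ v))) =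
      ∑ v ∈ S, inv v (locClass₂ (mu K n) (Place.Completion v)
          ((Pv v).cupSubCocycle (φ₁ v) (resOne ρY (Place.Completion v) g)
            (resTwo ρX (Place.Completion v) f) (hφ₁ v) (resCochain₂ (Place.Completion v) h₁)
            (dTwo_resCochain₂_of_cupCocycle₂₁ P Pv hPv h₁ hh₁ v))) := by
  have hc : ∀ v ∉ S, inv v (galoisCohomology.localization (mu K n) v 2
      (twoCocycleClass _ ⟨h₂ - h₁, pair_h_sub_mem P h₁ h₂ hh₁ hh₂⟩)) = 0 := fun v hv => by
    have e := pair_localTerm_eq_sub P Pv hPv h₁ h₂ hh₁ hh₂ φ₁ φ₂ hφ₁ hφ₂ inv v (hg v)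
    rw [hS₁ v hv, hS₂ v hv, zero_sub, eq_comm, neg_eq_zero] at e
    exact e
  rw [Finset.sum_congr rfl fun v _ => pair_localTerm_eq_sub P Pv hPv h₁ h₂ hh₁ hh₂ φ₁ φ₂ hφ₁ hφ₂ inv v (hg v),
    Finset.sum_sub_distrib, hPT' _ S hc, sub_zero]

/-- **THE canonical maps: a PRODUCED support for the second choice.**  If the first admissible choice has local terms vanishing
off the finite set `S` and summing to `0` over `S`, then for EVERY second admissible choice there is a finite `S' ⊇ S` off which
its local terms vanish and over which they sum to `0` — the support of `loc_v [z]` is finite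
(`exists_finset_place_forall_localization_mu_two_eq_zero`) and THE maps satisfy reciprocity
(`sumInvLocalizationEqZero_canonical_of_numberField`). [cite: MilneADT2006, Ch. I §4 Thm. 4.10 (a), Lemma 4.8]
[cite: CasselsFrohlichANT1967, Ch. VII §7.3 Prop. 7.3, §11.2] -/
theorem pair_support_and_sum_eq_zero_canonical [NeZero n]
    (hg : ∀ v : Place K, locClass ρY (Place.Completion v) (resOne ρY (Place.Completion v) g) = 0)
    {S : Finset (Place K)}
    (hS₁ : ∀ v ∉ S, LocalInvariants.canonical K n v (locClass₂ (mu K n) (Place.Completion v)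
        ((Pv v).cupSubCocycle (φ₁ v) (resOne ρY (Place.Completion v) g)
          (resTwo ρX (Place.Completion v) f) (hφ₁ v) (resCochain₂ (Place.Completion v) h₁)
          (dTwo_resCochain₂_of_cupCocycle₂₁ P Pv hPv h₁ hh₁ v))) = 0)
    (hsum₁ : ∑ v ∈ S, LocalInvariants.canonical K n v (locClass₂ (mu K n) (Place.Completion v)
        ((Pv v).cupSubCocycle (φ₁ v) (resOne ρY (Place.Completion v) g)
          (resTwo ρX (Place.Completion v) f) (hφ₁ v) (resCochain₂ (Place.Completion v) h₁)
          (dTwo_resCochain₂_of_cupCocycle₂₁ P Pv hPv h₁ hh₁ v))) = 0) :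
    ∃ S' : Finset (Place K), S ⊆ S' ∧
      (∀ v ∉ S', LocalInvariants.canonical K n v (locClass₂ (mu K n) (Place.Completion v)
        ((Pv v).cupSubCocycle (φ₂ v) (resOne ρY (Place.Completion v) g)
          (resTwo ρX (Place.Completion v) f) (hφ₂ v) (resCochain₂ (Place.Completion v) h₂)
          (dTwo_resCochain₂_of_cupCocycle₂₁ P Pv hPv h₂ hh₂ v))) = 0) ∧
      ∑ v ∈ S', LocalInvariants.canonical K n v (locClass₂ (mu K n) (Place.Completion v)
        ((Pv v).cupSubCocycle (φ₂ v) (resOne ρY (Place.Completion v) g)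
          (resTwo ρX (Place.Completion v) f) (hφ₂ v) (resCochain₂ (Place.Completion v) h₂)
          (dTwo_resCochain₂_of_cupCocycle₂₁ P Pv hPv h₂ hh₂ v))) = 0 := by
  obtain ⟨Sz, -, hSz⟩ := exists_finset_place_forall_localization_mu_two_eq_zero n
    (twoCocycleClass _ ⟨h₂ - h₁, pair_h_sub_mem P h₁ h₂ hh₁ hh₂⟩)
  refine ⟨S ∪ Sz, Finset.subset_union_left, fun v hv => ?_, ?_⟩
  · rw [pair_localTerm_eq_sub P Pv hPv h₁ h₂ hh₁ hh₂ φ₁ φ₂ hφ₁ hφ₂ (LocalInvariants.canonical K n) v (hg v),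
      hS₁ v fun h => hv (Finset.mem_union_left _ h), hSz v fun h => hv (Finset.mem_union_right _ h), map_zero, sub_zero]
  · have hS₁' : ∀ v ∉ S ∪ Sz, LocalInvariants.canonical K n v (locClass₂ (mu K n) (Place.Completion v)
        ((Pv v).cupSubCocycle (φ₁ v) (resOne ρY (Place.Completion v) g)
          (resTwo ρX (Place.Completion v) f) (hφ₁ v) (resCochain₂ (Place.Completion v) h₁)
          (dTwo_resCochain₂_of_cupCocycle₂₁ P Pv hPv h₁ hh₁ v))) = 0 :=
      fun v hv => hS₁ v fun h => hv (Finset.mem_union_left _ h)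
    have hz : ∀ v ∉ S ∪ Sz, LocalInvariants.canonical K n v (galoisCohomology.localization (mu K n) v 2
        (twoCocycleClass _ ⟨h₂ - h₁, pair_h_sub_mem P h₁ h₂ hh₁ hh₂⟩)) = 0 := fun v hv => by
      rw [hSz v fun h => hv (Finset.mem_union_right _ h), map_zero]
    rw [Finset.sum_congr rfl fun v _ =>
        pair_localTerm_eq_sub P Pv hPv h₁ h₂ hh₁ hh₂ φ₁ φ₂ hφ₁ hφ₂ (LocalInvariants.canonical K n) v (hg v),
      Finset.sum_sub_distrib, sumInvLocalizationEqZero_canonical_of_numberField K n _ _ hz, sub_zero,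
      ← Finset.sum_subset Finset.subset_union_left fun v _ hv => hS₁ v hv, hsum₁]

end Two

end Summit.BirchSwinnertonDyer.BirchSwinnertonDyer.Theorems.ShaTwoCochain

end
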